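import Literature.Analysis.OperatorTheory.Enflo2023.Basic
import Literature.Analysis.OperatorTheory.Enflo2023.Reductions
import Literature.Analysis.OperatorTheory.Enflo2023.PolyCompactCase
import HarnessLib

/-!
# Enflo 2023, repair census: NORMAL operators (row R9) — the theorem closed in Lean, outside the mechanism

Source under adjudication: Per H. Enflo, *On the invariant subspace problem in Hilbert spaces*, arXiv:2305.15442 (v1
2023, v2 2024), bib key `Enflo2023` — a CLAIMED proof of the invariant subspace problem for operators on a separable
Hilbert space.  This file is part of the kernel-tight typing of the manuscript by the b2b-enflo repair cell
(formaliser 2, Part B: (28)–(47), the limiting argument and the final deduction).  It records what FOLLOWS (proved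
implications from the manuscript's displayed hypotheses) and, where a step does not follow, the typed inference
together with its refutation.  NOTHING here asserts that the manuscript's main theorem holds; no declaration concludes
the invariant subspace problem for an arbitrary operator.  Value (BLOCK-2b): theorems / refutations of typed
inferences about a text — not progress on the problem.

REPAIR-CENSUS row R9 ("`T` normal or self-adjoint"), THEOREM column, CLOSED IN LEAN.  The census (REPAIR-CENSUS.md,
formaliser 2) recorded this row as "known theorem (spectral theorem), not re-proved; Mathlib has the spectral theorem for
compact self-adjoint operators only".  The second clause was too pessimistic: Mathlib's continuous functional calculus for
normal elements of a C⋆-algebra (`cfc`, instance `IsStarNormal.instContinuousFunctionalCalculus` on `H →L[ℂ] H`) and its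
Fuglede–Putnam–Rosenblum theorem (`IsStarNormal.commute_star_right`) are exactly what the classical proof needs, and this
file carries it out:

* `eq_smul_one_of_spectrum_subset_singleton`: a normal operator whose spectrum is (contained in) one point is a scalar
  (`cfc_id` / `cfc_congr` / `cfc_const`);
* `exists_continuous_separating`: for `a ≠ b` in `ℂ` two continuous cone bumps `f, g` with `f a ≠ 0`, `g b ≠ 0`,
  `g·f = 0` identically;
* `exists_annihilating_pair_of_isStarNormal`: for a NON-SCALAR normal `N` (so `σ(N)` has two points, Gelfand:
  `spectrum.nonempty`) the operators `F = f(N) ≠ 0`, `G = g(N) ≠ 0` satisfy `G F = 0` (spectral mapping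
  `cfc_map_spectrum`, `cfc_mul`), and `G` commutes with every `S` commuting with `N` (Fuglede + `Commute.cfc`);
* `exists_hyperinvariant_of_annihilating_pair`: then `ker G` is a closed subspace, `≠ ⊤` (`G ≠ 0`), `≠ ⊥` (it contains
  `range F ≠ 0`), invariant under every such `S` — i.e. a non-trivial closed HYPERINVARIANT subspace;
* `exists_hyperinvariant_of_isStarNormal` = Radjavi–Rosenthal, *Invariant Subspaces* (1973), Corollary 1.17: every
  non-scalar normal operator has a non-trivial (closed) hyperinvariant subspace [cite: RadjaviRosenthal1973, Cor. 1.17];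
* consequences in the census vocabulary (`HasNontrivialClosedInvariantSubspace`, `Basic.lean`):
  `hasNontrivialClosedInvariantSubspace_of_isStarNormal` (normal `T`, `dim H ≥ 2` as `1 < Module.rank ℂ H`; the scalar
  case is an eigenline, `Reductions.lean`), `…_of_isSelfAdjoint`, `…_of_commute_isStarNormal` (any `T` commuting with a
  non-scalar normal operator), `…_of_norm_map_eq` (isometries: closed range, or unitary hence normal), and
  `…_of_isStarNormal_MC` (the row in the shape of R8/R12: normal `T` plus the p.4 Main-Construction output data, which is
  used ONLY to exclude `dim H ≤ 1` via `two_le_finrank_of_MC`).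

Reading for the census.  As for R8 (compact) and R12 (polynomially compact), it is NOT the manuscript's mechanism (norm
convergence of the MC outputs, the room claim of v2 p.20 — refuted for a self-adjoint `T` with every standing hypothesis
in `RoomClaimT.lean`, row R13) that proves the theorem in this class: the functional calculus does, and no Main
Construction data is needed at all.  What stays open as a THEOREM is row R10 (essentially normal `T = N + K`, `N` normal
non-algebraic, `K` compact), where neither a compact polynomial in `T` (R12) nor the functional calculus of `T` (this
file: `T` itself is not normal) is available.  The results here are classical and not claimed new.
Origin: planner-b2b-enflo-2-g3-0 (formaliser 2, gen-3), 2026-08-18.  Mathlib only (CFC, Fuglede–Putnam–Rosenblum).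
-/

open scoped InnerProductSpace
open Filter Topology

namespace Literature.Analysis.OperatorTheory.Enflo2023

variable {H : Type*} [NormedAddCommGroup H] [InnerProductSpace ℂ H] [CompleteSpace H]

/-! ### Kernels of commuting operators are invariant -/

omit [CompleteSpace H] in
/-- If `S` commutes with `G` then `ker G` is invariant under `S`. [folklore] -/
lemma isInvariant_ker_of_commute (S G : H →L[ℂ] H) (h : Commute S G) :
    IsInvariant S (LinearMap.ker (G : H →ₗ[ℂ] H)) := by
  intro x hx
  simp only [LinearMap.mem_ker, ContinuousLinearMap.coe_coe] at hx ⊢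
  have e := congrArg (fun R : H →L[ℂ] H => R x) h.eq
  simp only [mul_apply_eq_comp, hx, map_zero] at e
  -- e : S (G x) = G (S x) with G x = 0
  exact e.symm

omit [CompleteSpace H] in
/-- An ANNIHILATING PAIR gives a hyperinvariant subspace: if `F ≠ 0`, `G ≠ 0`, `G F = 0` and `G` commutes with every
operator commuting with `N`, then `ker G` is a closed subspace, `≠ ⊥`, `≠ ⊤`, invariant under every operator commuting
with `N`. [folklore] -/
theorem exists_hyperinvariant_of_annihilating_pair (N F G : H →L[ℂ] H) (hF : F ≠ 0) (hG : G ≠ 0)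
    (hGF : G * F = 0) (hcomm : ∀ S : H →L[ℂ] H, Commute S N → Commute S G) :
    ∃ M : Submodule ℂ H, IsClosed (M : Set H) ∧ M ≠ ⊥ ∧ M ≠ ⊤ ∧
      ∀ S : H →L[ℂ] H, Commute S N → IsInvariant S M := by
  refine ⟨LinearMap.ker (G : H →ₗ[ℂ] H), G.isClosed_ker, ?_, ?_,
    fun S hS => isInvariant_ker_of_commute S G (hcomm S hS)⟩
  · -- `range F ≤ ker G` and `F ≠ 0`
    intro hbot
    apply hF; ext x
    have hx : F x ∈ LinearMap.ker (G : H →ₗ[ℂ] H) := by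
      simp only [LinearMap.mem_ker, ContinuousLinearMap.coe_coe]
      have e := congrArg (fun R : H →L[ℂ] H => R x) hGF
      simpa only [mul_apply_eq_comp, zero_apply] using e
    rw [hbot, Submodule.mem_bot] at hx
    simpa using hx
  · intro htop
    apply hG; ext x
    have hx : x ∈ LinearMap.ker (G : H →ₗ[ℂ] H) := htop ▸ Submodule.mem_top
    simpa using hx

/-! ### Two continuous bumps with disjoint supports -/

/-- For `a ≠ b` in `ℂ`: continuous `f, g : ℂ → ℂ` (cone bumps of radius `|a − b|/2`) with `f a ≠ 0`, `g b ≠ 0` and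
`g z · f z = 0` for every `z`. [folklore] -/
lemma exists_continuous_separating {a b : ℂ} (hab : a ≠ b) :
    ∃ f g : ℂ → ℂ, Continuous f ∧ Continuous g ∧ f a ≠ 0 ∧ g b ≠ 0 ∧ ∀ z, g z * f z = 0 := by
  set r : ℝ := dist a b / 2 with hr
  have hr0 : 0 < r := by rw [hr]; exact half_pos (dist_pos.mpr hab)
  refine ⟨fun z => ((max (r - dist z a) 0 : ℝ) : ℂ), fun z => ((max (r - dist z b) 0 : ℝ) : ℂ), ?_, ?_, ?_, ?_, ?_⟩
  · exact Complex.continuous_ofReal.comp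
      ((continuous_const.sub (continuous_id.dist continuous_const)).max continuous_const)
  · exact Complex.continuous_ofReal.comp
      ((continuous_const.sub (continuous_id.dist continuous_const)).max continuous_const)
  · have e : max (r - dist a a) 0 = r := by rw [dist_self, sub_zero, max_eq_left hr0.le]
    simp only [e, ne_eq, Complex.ofReal_eq_zero]
    exact hr0.ne'
  · have e : max (r - dist b b) 0 = r := by rw [dist_self, sub_zero, max_eq_left hr0.le]
    simp only [e, ne_eq, Complex.ofReal_eq_zero]
    exact hr0.ne'
  · intro z
    by_cases hz : dist z a < r
    · have htri := dist_triangle_left a b z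
      have h2 : r - dist z b ≤ 0 := by rw [hr] at hz ⊢; linarith
      simp [max_eq_right h2]
    · push Not at hz
      have h1 : r - dist z a ≤ 0 := by linarith
      simp [max_eq_right h1]

/-! ### Functional calculus of a normal operator -/

/-- A normal operator whose spectrum lies in one point `{c}` is the scalar `c • 1` (functional calculus: `id = const c`
on the spectrum). [folklore] -/
lemma eq_smul_one_of_spectrum_subset_singleton (N : H →L[ℂ] H) [IsStarNormal N] {c : ℂ}
    (h : spectrum ℂ N ⊆ {c}) : N = c • (1 : H →L[ℂ] H) := by
  calc N = cfc (id : ℂ → ℂ) N := (cfc_id ℂ N).symm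
    _ = cfc (fun _ : ℂ => c) N := cfc_congr fun z hz => by simpa using h hz
    _ = algebraMap ℂ (H →L[ℂ] H) c := cfc_const c N
    _ = c • (1 : H →L[ℂ] H) := Algebra.algebraMap_eq_smul_one c

omit [InnerProductSpace ℂ H] [CompleteSpace H] in
/-- A non-trivial space has non-trivial operator algebra (`1 ≠ 0`). [folklore] -/
lemma nontrivial_clm [InnerProductSpace ℂ H] [Nontrivial H] : Nontrivial (H →L[ℂ] H) := by
  obtain ⟨x, hx⟩ := exists_ne (0 : H)
  exact nontrivial_of_ne 1 0 fun h => hx (by simpa using congrArg (fun S : H →L[ℂ] H => S x) h)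

/-- ANNIHILATING PAIR IN `C*(N)`.  For a non-scalar normal operator `N` there are operators `F ≠ 0`, `G ≠ 0` with
`G F = 0`, `G` commuting with every operator that commutes with `N`.  (`σ(N)` is non-empty (Gelfand) and not a single
point (else `N` is scalar), so pick `a ≠ b` in `σ(N)` and bumps `f, g` as above; `F = f(N)`, `G = g(N)` by the
continuous functional calculus; `F, G ≠ 0` by spectral mapping; `G F = (g f)(N) = 0`; commutation by
Fuglede–Putnam–Rosenblum `S N = N S ⇒ S N^* = N^* S` and `Commute.cfc`.) [folklore] -/
theorem exists_annihilating_pair_of_isStarNormal (N : H →L[ℂ] H) (hN : IsStarNormal N)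
    (hN' : ∀ c : ℂ, N ≠ c • (1 : H →L[ℂ] H)) :
    ∃ F G : H →L[ℂ] H, F ≠ 0 ∧ G ≠ 0 ∧ G * F = 0 ∧ ∀ S : H →L[ℂ] H, Commute S N → Commute S G := by
  have hnt : Nontrivial H := by
    by_contra hH
    rw [not_nontrivial_iff_subsingleton] at hH
    exact hN' 0 (by ext x; simp [Subsingleton.elim x 0])
  haveI : Nontrivial (H →L[ℂ] H) := nontrivial_clm
  obtain ⟨a, ha⟩ := spectrum.nonempty N
  obtain ⟨b, hb, hba⟩ : ∃ b ∈ spectrum ℂ N, b ≠ a := by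
    by_contra hcon
    push Not at hcon
    exact hN' a (eq_smul_one_of_spectrum_subset_singleton N fun z hz => hcon z hz)
  obtain ⟨f, g, hfc, hgc, hfa, hgb, hgf⟩ := exists_continuous_separating hba.symm
  refine ⟨cfc f N, cfc g N, ?_, ?_, ?_, ?_⟩
  · intro h0
    have hs : spectrum ℂ (cfc f N) = f '' spectrum ℂ N := cfc_map_spectrum f N (hf := hfc.continuousOn)
    have : f a ∈ spectrum ℂ (cfc f N) := hs ▸ ⟨a, ha, rfl⟩
    rw [h0, spectrum.zero_eq, Set.mem_singleton_iff] at this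
    exact hfa this
  · intro h0
    have hs : spectrum ℂ (cfc g N) = g '' spectrum ℂ N := cfc_map_spectrum g N (hf := hgc.continuousOn)
    have : g b ∈ spectrum ℂ (cfc g N) := hs ▸ ⟨b, hb, rfl⟩
    rw [h0, spectrum.zero_eq, Set.mem_singleton_iff] at this
    exact hgb this
  · rw [← cfc_mul g f N hgc.continuousOn hfc.continuousOn]
    have e : (fun z => g z * f z) = (0 : ℂ → ℂ) := funext fun z => by simpa using hgf z
    rw [e, cfc_zero]
  · intro S hS
    -- Fuglede–Putnam–Rosenblum: `S` commutes with `N^*` too, hence with `g(N)`.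
    have h1 : Commute N S := hS.symm
    have h2 : Commute (star N) S := hN.commute_star_left h1
    exact (h1.cfc h2 g).symm

/-- **Radjavi–Rosenthal 1973, Corollary 1.17: every non-scalar normal operator on a complex Hilbert space has a
non-trivial closed HYPERINVARIANT subspace** (invariant under every operator commuting with it).
[cite: RadjaviRosenthal1973, Cor. 1.17] -/
theorem exists_hyperinvariant_of_isStarNormal (N : H →L[ℂ] H) (hN : IsStarNormal N)
    (hN' : ∀ c : ℂ, N ≠ c • (1 : H →L[ℂ] H)) :
    ∃ M : Submodule ℂ H, IsClosed (M : Set H) ∧ M ≠ ⊥ ∧ M ≠ ⊤ ∧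
      ∀ S : H →L[ℂ] H, Commute S N → IsInvariant S M := by
  obtain ⟨F, G, hF, hG, hGF, hcomm⟩ := exists_annihilating_pair_of_isStarNormal N hN hN'
  exact exists_hyperinvariant_of_annihilating_pair N F G hF hG hGF hcomm

/-! ### Census row R9 in the vocabulary of `Basic.lean` -/

/-- Any operator commuting with a NON-SCALAR NORMAL operator has a non-trivial closed invariant subspace.
[cite: RadjaviRosenthal1973, Cor. 1.17] -/
theorem hasNontrivialClosedInvariantSubspace_of_commute_isStarNormal (T N : H →L[ℂ] H) (hN : IsStarNormal N)
    (hN' : ∀ c : ℂ, N ≠ c • (1 : H →L[ℂ] H)) (hTN : Commute T N) :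
    HasNontrivialClosedInvariantSubspace T := by
  obtain ⟨M, hMc, hMb, hMt, hMi⟩ := exists_hyperinvariant_of_isStarNormal N hN hN'
  exact ⟨M, hMc, hMb, hMt, hMi T hTN⟩

omit [InnerProductSpace ℂ H] [CompleteSpace H] in
/-- `dim H ≥ 2` (as `1 < Module.rank ℂ H`) means no single vector spans `H`. [folklore] -/
lemma span_singleton_ne_top_of_one_lt_rank [InnerProductSpace ℂ H] (hH : 1 < Module.rank ℂ H) (v : H) :
    (ℂ ∙ v) ≠ ⊤ := by
  intro htop
  have : Module.rank ℂ H ≤ 1 := by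
    rw [rank_le_one_iff]
    refine ⟨v, fun w => ?_⟩
    have hw : w ∈ (ℂ ∙ v) := htop ▸ Submodule.mem_top
    rw [Submodule.mem_span_singleton] at hw
    exact hw
  exact not_lt.mpr this hH

/-- **REPAIR CENSUS R9, closed in Lean: a NORMAL operator on a complex Hilbert space of dimension `≥ 2` has a
non-trivial closed invariant subspace** — hyperinvariant if `T` is not a scalar (Cor. 1.17), an eigenline if it is.
No Main-Construction data, no room claim: the manuscript's mechanism (refuted for self-adjoint `T` in `RoomClaimT.lean`)
plays no role. [cite: RadjaviRosenthal1973, Cor. 1.17] -/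
theorem hasNontrivialClosedInvariantSubspace_of_isStarNormal (T : H →L[ℂ] H) (hT : IsStarNormal T)
    (hH : 1 < Module.rank ℂ H) : HasNontrivialClosedInvariantSubspace T := by
  by_cases hsc : ∃ c : ℂ, T = c • (1 : H →L[ℂ] H)
  · obtain ⟨c, rfl⟩ := hsc
    have : Nontrivial H := rank_pos_iff_nontrivial.mp (lt_trans zero_lt_one hH)
    obtain ⟨v, hv⟩ := exists_ne (0 : H)
    exact hasNontrivialClosedInvariantSubspace_of_eigenvector _ (μ := c) hv (by simp)
      (span_singleton_ne_top_of_one_lt_rank hH v)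
  · push Not at hsc
    exact hasNontrivialClosedInvariantSubspace_of_commute_isStarNormal T T hT hsc (Commute.refl T)

/-- Self-adjoint operators (in particular positive operators, orthogonal projections) are normal: census R9,
self-adjoint clause. [cite: RadjaviRosenthal1973, Cor. 1.17] -/
theorem hasNontrivialClosedInvariantSubspace_of_isSelfAdjoint (T : H →L[ℂ] H) (hT : IsSelfAdjoint T)
    (hH : 1 < Module.rank ℂ H) : HasNontrivialClosedInvariantSubspace T :=
  hasNontrivialClosedInvariantSubspace_of_isStarNormal T hT.isStarNormal hH

/-- ISOMETRIES (`‖V x‖ = ‖x‖`): either the range of `V` is a proper CLOSED invariant subspace, or `V` is onto, hence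
unitary, hence normal. [folklore] -/
theorem hasNontrivialClosedInvariantSubspace_of_norm_map_eq (V : H →L[ℂ] H) (hV : ∀ x, ‖V x‖ = ‖x‖)
    (hH : 1 < Module.rank ℂ H) : HasNontrivialClosedInvariantSubspace V := by
  have hnt : Nontrivial H := rank_pos_iff_nontrivial.mp (lt_trans zero_lt_one hH)
  have hV1 : ContinuousLinearMap.adjoint V * V = 1 := (ContinuousLinearMap.norm_map_iff_adjoint_comp_self V).mp hV
  -- the range is closed (isometry from a complete space)
  have hiso : Isometry V := AddMonoidHomClass.isometry_of_norm V hV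
  have hcl : IsClosed (LinearMap.range (V : H →ₗ[ℂ] H) : Set H) := by
    have := hiso.isClosedEmbedding.isClosed_range
    simpa [LinearMap.coe_range] using this
  by_cases htop : LinearMap.range (V : H →ₗ[ℂ] H) = ⊤
  · -- `V` is onto: `V V^* = 1` as well, so `V` is normal
    have hsurj : Function.Surjective V := by
      intro y
      have hy : y ∈ LinearMap.range (V : H →ₗ[ℂ] H) := htop ▸ Submodule.mem_top
      obtain ⟨x, hx⟩ := hy
      exact ⟨x, hx⟩
    have hV2 : V * ContinuousLinearMap.adjoint V = 1 := by
      ext y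
      obtain ⟨x, rfl⟩ := hsurj y
      have e := congrArg (fun R : H →L[ℂ] H => V (R x)) hV1
      simpa only [mul_apply_eq_comp, one_apply_eq_self] using e
    have hn : IsStarNormal V := by
      refine ⟨?_⟩
      rw [ContinuousLinearMap.star_eq_adjoint, commute_iff_eq, hV1, hV2]
    exact hasNontrivialClosedInvariantSubspace_of_isStarNormal V hn hH
  · refine hasNontrivialClosedInvariantSubspace_of_range_not_dense V ?_ ?_
    · rwa [hcl.submodule_topologicalClosure_eq]
    · obtain ⟨x, hx⟩ := exists_ne (0 : H)
      intro h0
      have := hV x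
      rw [h0, zero_apply, norm_zero] at this
      exact hx (norm_eq_zero.mp this.symm)

/-! ### The row in the shape of R8/R12: normal `T` plus the p.4 Main-Construction data -/

omit [CompleteSpace H] in
/-- The p.4 MC output data force `dim H ≥ 2` as a cardinal (`1 < Module.rank ℂ H`): in finite dimension by
`two_le_finrank_of_MC` (`PolyCompactCase.lean`), in infinite dimension trivially. [folklore] -/
lemma one_lt_rank_of_MC (x₀ : H) (hx₀ : ‖x₀‖ = 1) (w : ℕ → H) (ε : ℕ → ℝ)
    (hdist : ∀ n, 0.3 ≤ ‖x₀ - w n‖ ∧ ‖x₀ - w n‖ ≤ 0.7) (hε : Tendsto ε atTop (𝓝 0))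
    (h0 : ∀ n, ‖⟪x₀ - w n, w n⟫_ℂ‖ ≤ ε n) : 1 < Module.rank ℂ H := by
  by_cases hfin : FiniteDimensional ℂ H
  · have h2 := two_le_finrank_of_MC x₀ hx₀ w ε hdist hε h0
    rw [← Module.finrank_eq_rank]
    exact_mod_cast (by omega : 1 < Module.finrank ℂ H)
  · have hle : Cardinal.aleph0 ≤ Module.rank ℂ H := by
      by_contra hlt
      exact hfin (Module.rank_lt_aleph0_iff.mp (not_le.mp hlt))
    exact lt_of_lt_of_le Cardinal.one_lt_aleph0 hle

/-- **REPAIR CENSUS R9 in the shape of R8/R12**: `T` NORMAL and ANY sequence of Main-Construction outputs as on v2 p.4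
(`‖x₀‖ = 1`, `0.3 ≤ ‖x₀ − w_n‖ ≤ 0.7`, (9) `|⟨x₀ − w_n, T^j w_n⟩| ≤ ε_n → 0`) give a non-trivial closed invariant
subspace — the data are used ONLY to exclude `dim H ≤ 1`; no weak or norm limit, no room claim, no injectivity.
[cite: Enflo2023, v2 p.4 (11) and p.20] -/
theorem hasNontrivialClosedInvariantSubspace_of_isStarNormal_MC (T : H →L[ℂ] H) (hT : IsStarNormal T)
    (x₀ : H) (hx₀ : ‖x₀‖ = 1) (w : ℕ → H) (ε : ℕ → ℝ)
    (hdist : ∀ n, 0.3 ≤ ‖x₀ - w n‖ ∧ ‖x₀ - w n‖ ≤ 0.7) (hε : Tendsto ε atTop (𝓝 0))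
    (h : ∀ n j, ‖⟪x₀ - w n, (T ^ j) (w n)⟫_ℂ‖ ≤ ε n) : HasNontrivialClosedInvariantSubspace T :=
  hasNontrivialClosedInvariantSubspace_of_isStarNormal T hT
    (one_lt_rank_of_MC x₀ hx₀ w ε hdist hε fun n => by simpa using h n 0)

end Literature.Analysis.OperatorTheory.Enflo2023
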